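import Summits.BirchSwinnertonDyer.BirchSwinnertonDyer.Theorems.SignedLowerHalvesSmallImageLowerHalfBothSignsRttCharRoadE1CoresNaturality
import Summits.BirchSwinnertonDyer.BirchSwinnertonDyer.Theorems.SignedLowerHalvesSmallImageLowerHalfBothSignsRttCharRoadE1CoresPair
import Summits.BirchSwinnertonDyer.Rank1Residual.GaloisImage.AbelianExtensionTorsionFields
import Literature.NumberTheory.EllipticCurves.TwoVariableAnticyclotomicControl
import Literature.NumberTheory.EllipticCurves.SelmerCorankAssembly
import HarnessLib

/-!
# Route `SignedLowerHalves`, crux L `SmallImageLowerHalfBothSigns` (stmt-BirchSwinnertonDyer-23599), line `rtt_w3` v12 — glue brick §2 (THE INJECTIVITY CORE of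
# `charRoad_injTop`, ℚ-side): for a `W[p]`-class `ζ ∈ H¹(N, W[p])` over a layer `H = Γ_{ℚ_n}` (`N` open normal of index two with transversal `c`), if the
# restrictions to `Γ_{ℚ_∞}` of BOTH corestricted `W[p^∞]`-classes `cor (ι_* ζ)` and `cor (ι_* (u_* ζ))` vanish, then `ζ = 0` — assembling the landed pieces:
# `res` is injective on `H¹(ℚ_n, W[p^∞])` (`W(ℚ_∞)[p^∞] = 0` from irreducibility, tree `fixedPoints_kerSubgroup_eq_bot_of_irreducible` +
# `resOfLe_injective_of_forall_fixed_eq_zero`), `cor` is natural along `ι : W[p] ↪ W[p^∞]` (I′ p767726), `ι_*` is injective on `H¹(ℚ_n, ·)` (`W(ℚ_n)[p^∞] = 0`;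
# this file, §1), and the cores pair `(cor, cor ∘ u_*)` is injective on `H¹(N, W[p])` (block I p767436, passed in as `hinj`).

LEAD `cruxlead-stmt-BirchSwinnertonDyer-23599` g7 (cell `bsd-ssimc`; `--supports stmt-BirchSwinnertonDyer-23599 --as helper`). THEOREMS ONLY (no definition, no named fact,
no instance, no `sorry`). BSD / crux L / INJ_top are NOT proved here.

WHAT: §1 generic ★ `resH1Hom_id_injective_of_torsionBy` (`ι_* : H¹(H, A) → H¹(H, M)` injective for `ι : A ↪ M` onto `M[p]`, `A` killed by `p`, `M^H` without `p`-torsion);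
§2 ★★ `eq_zero_of_resOfLe_corH1_pair_eq_zero` (the injectivity core over `ℚ`).

References: [SerreGaloisCohomology1997] I §2.6 (b), I §5; [GreenbergVatsal2000] §2 p. 19 («`Sel(E[p]) → Sel(E[p^∞])[p]`»); [GreenbergLNM1716] §3 Lemma 3.1, §4 p. 109.
-/

set_option autoImplicit false
set_option linter.dupNamespace false -- D-0017: single-problem summit, the namespace repeats the problem name by design
noncomputable section

open scoped Classical

universe u

namespace Summit.BirchSwinnertonDyer.BirchSwinnertonDyer.Theorems.SmallImageCharSignedSelmer

open Literature.NumberTheory.EllipticCurves Literature.NumberTheory.GaloisRepresentations WeierstrassCurve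

/-! ## §1 `ι_*` is injective on `H¹` when the invariants have no `p`-torsion -/

section Generic

variable {G : Type u} [Group G] [TopologicalSpace G] [IsTopologicalGroup G] {H : Subgroup G}
  {M : Type u} [AddCommGroup M] [DistribMulAction G M] [TopologicalSpace M] [DiscreteTopology M]
  {A : Type u} [AddCommGroup A] [DistribMulAction G A] [TopologicalSpace A] [DiscreteTopology A]

/-- ★ **`ι_* : H¹(H, A) → H¹(H, M)` is injective** for an injective `G`-equivariant `ι : A → M` whose image contains `M[p]`, `A` killed by `p`, and `M^H` without
non-zero element killed by `p` (e.g. `M^H = 0`): if `ι ∘ g = ∂b` then `p b ∈ M^H`, so `p b = 0`, `b = ι a`, `g = ∂a`.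
[cite: GreenbergVatsal2000, §2 p. 19] [cite: SerreGaloisCohomology1997, I §5.1] -/
theorem resH1Hom_id_injective_of_torsionBy (ι : A →+ M) (hι : ∀ (g : G) (a : A), ι (g • a) = g • ι a) (hιinj : Function.Injective ι)
    (p : ℕ) (hpA : ∀ a : A, p • a = 0) (hrange : ∀ m : M, p • m = 0 → m ∈ Set.range ι)
    (hH0 : ∀ m : M, (∀ x : H, x • m = m) → m = 0) :
    Function.Injective (resH1Hom (ContinuousMonoidHom.id H) ι (fun x a ↦ hι (x : G) a)) := by
  rw [injective_iff_map_eq_zero]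
  intro ζ hζ
  obtain ⟨g, rfl⟩ := oneCocycleClass_surjective _ ζ
  have hmap : resH1Hom (ContinuousMonoidHom.id H) ι (fun x a ↦ hι (x : G) a) (oneCocycleClass _ g) =
      oneCocycleClass (discreteTopRep H M)
        (contOneCocycles.pullback (ContinuousMonoidHom.id H) (resHomOfEquivariant (ContinuousMonoidHom.id H) ι (fun x a ↦ hι (x : G) a)) g) :=
    map_oneCocycleClass (X := discreteTopRep H A) (Y := discreteTopRep H M) (ContinuousMonoidHom.id H)
      (resHomOfEquivariant (ContinuousMonoidHom.id H) ι (fun x a ↦ hι (x : G) a)) g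
  rw [hmap, oneCocycleClass_eq_zero_iff] at hζ
  obtain ⟨b, hb⟩ := hζ
  have hb' : ∀ x : H, ι (g.1 x) = (x : G) • b - b := fun x ↦ hb x
  -- `p • b` is `H`-fixed, hence zero; so `b = ι a` and `g = ∂a`
  have hpb : ∀ x : H, x • (p • b) = p • b := fun x ↦ by
    have h1 : p • ((x : G) • b - b) = 0 := by rw [← hb' x, ← map_nsmul, hpA, map_zero]
    rw [smul_sub, sub_eq_zero] at h1
    change (x : G) • (p • b) = p • b
    rw [smul_comm]
    exact h1
  obtain ⟨a, ha⟩ := hrange b (hH0 (p • b) hpb)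
  rw [oneCocycleClass_eq_zero_iff]
  refine ⟨a, fun x ↦ hιinj ?_⟩
  change ι (g.1 x) = ι ((x : G) • a - a)
  rw [map_sub, hι, ha]
  exact hb' x

end Generic

/-! ## §2 The injectivity core over `ℚ` -/

section Rational

variable {W : WeierstrassCurve ℚ} [W.IsElliptic] {p : ℕ} [Fact p.Prime] (κ : ZpExtension ℚ p)

omit [W.IsElliptic] [Fact p.Prime] in
/-- The inclusion `W[p] ↪ W[p^∞]` is `Γ_ℚ`-equivariant (both actions are the action on geometric points). [folklore] -/
theorem inclusion_geomTorsion_smul (g : Field.absoluteGaloisGroup ℚ) (a : geomTorsion W p) :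
    AddSubgroup.inclusion (W.geomTorsion_le_geomPrimaryTorsion p) (g • a) = g • AddSubgroup.inclusion (W.geomTorsion_le_geomPrimaryTorsion p) a :=
  Subtype.ext rfl

omit [W.IsElliptic] [Fact p.Prime] in
/-- `W[p^∞][p]` is the image of `W[p]`. [folklore] -/
theorem mem_range_inclusion_of_nsmul_eq_zero (m : W.geomPrimaryTorsion p) (hm : p • m = 0) :
    m ∈ Set.range (AddSubgroup.inclusion (W.geomTorsion_le_geomPrimaryTorsion p)) := by
  have h' : ((p : ℕ) : ℤ) • ((m : W.geomPrimaryTorsion p) : W.geomPoints) = 0 := by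
    rw [natCast_zsmul, ← AddSubgroupClass.coe_nsmul, hm, ZeroMemClass.coe_zero]
  exact ⟨⟨m, (WeierstrassCurve.mem_torsionPoints_iff _ _ _).mpr h'⟩, Subtype.ext rfl⟩

/-- **`W[p^∞]^{Γ_{ℚ_n}} = 0`** for every layer of a `ℤ_p`-extension of `ℚ` when `ρ̄_{W,p}` is irreducible (`W(ℚ_∞)[p^∞] = 0`, tree
`fixedPoints_kerSubgroup_eq_bot_of_irreducible`, and `Γ_{ℚ_∞} ≤ Γ_{ℚ_n}`). [cite: GreenbergLNM1716, §4 p. 109] -/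
theorem forall_layerSubgroup_fixed_eq_zero (hirr : W.HasIrreducibleModPGaloisRep p) (n : ℕ) (m : W.geomPrimaryTorsion p)
    (hm : ∀ x : κ.layerSubgroup n, x • m = m) : m = 0 := by
  have h := Summit.BirchSwinnertonDyer.Rank1Residual.GaloisImage.fixedPoints_kerSubgroup_eq_bot_of_irreducible W p hirr κ
  have hm' : m ∈ FixedPoints.addSubgroup κ.kerSubgroup (W.geomPrimaryTorsion p) := by
    rw [FixedPoints.mem_addSubgroup]
    exact fun x ↦ hm ⟨x, κ.kerSubgroup_le_layerSubgroup n x.2⟩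
  rw [h] at hm'
  exact (AddSubgroup.mem_bot).1 hm'

/-- **Restriction `H¹(ℚ_n, W[p^∞]) → H¹(ℚ_∞, W[p^∞])` is injective** under irreducibility (inflation–restriction, `W(ℚ_∞)[p^∞] = 0`).
[cite: GreenbergLNM1716, §3 Lemma 3.1] -/
theorem resOfLe_kerSubgroup_injective (hirr : W.HasIrreducibleModPGaloisRep p) (n : ℕ) :
    Function.Injective (W.resOfLe p (κ.kerSubgroup_le_layerSubgroup n)) := by
  have hfix : ∀ m : W.geomPrimaryTorsion p, (∀ x ∈ κ.kerSubgroup, x • m = m) → m = 0 := fun m hm ↦ by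
    have h := Summit.BirchSwinnertonDyer.Rank1Residual.GaloisImage.fixedPoints_kerSubgroup_eq_bot_of_irreducible W p hirr κ
    have hm' : m ∈ FixedPoints.addSubgroup κ.kerSubgroup (W.geomPrimaryTorsion p) := by
      rw [FixedPoints.mem_addSubgroup]; exact fun x ↦ hm x x.2
    rw [h] at hm'
    exact (AddSubgroup.mem_bot).1 hm'
  exact resOfLe_injective_of_forall_fixed_eq_zero (κ.kerSubgroup_le_layerSubgroup n) hfix

/-- ★★ **The injectivity core of `charRoad_injTop` (ℚ side).** `κ` a `ℤ_p`-extension of `ℚ`, `ρ̄_{W,p}` irreducible; `H = Γ_{ℚ_n}`, `N ≤ H` open normal with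
transversal `c` (`G = N ⊔ Nc`); `u : W[p] → W[p]` additive `N`-equivariant such that the cores pair `ξ ↦ (cor ξ, cor (u_* ξ))` is injective on `H¹(N, W[p])`
(block I, `exists_injective_corH1_pair_geomTorsion`). If for a class `ζ ∈ H¹(N, W[p])` the restrictions to `Γ_{ℚ_∞}` of the corestricted `W[p^∞]`-classes
`cor (ι_* ζ)` and `cor (ι_* (u_* ζ))` both vanish, then `ζ = 0`. (res injective: `resOfLe_kerSubgroup_injective`; cor natural along `ι`: `resH1Hom_corH1_comm`;
`ι_*` injective on `H¹(ℚ_n, ·)`: §1 with `W[p^∞]^{Γ_{ℚ_n}} = 0`.) [cite: SerreGaloisCohomology1997, I §2.6 (b)] [cite: GreenbergVatsal2000, §2 p. 19] -/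
theorem eq_zero_of_resOfLe_corH1_pair_eq_zero (hirr : W.HasIrreducibleModPGaloisRep p) {n : ℕ}
    {N : Subgroup (κ.layerSubgroup n)} [N.Normal] (hN : IsOpen (N : Set (κ.layerSubgroup n)))
    (hMp : ∀ m : geomTorsion W p, Continuous fun g : κ.layerSubgroup n ↦ g • m)
    (hMT : ∀ m : W.geomPrimaryTorsion p, Continuous fun g : κ.layerSubgroup n ↦ g • m)
    {c : κ.layerSubgroup n} (hc : ∀ b : κ.layerSubgroup n, Xor (b * c⁻¹ ∈ N) (b ∈ N))
    (u : geomTorsion W p →+ geomTorsion W p) (hu : ∀ (x : N) (m : geomTorsion W p), u (x • m) = x • u m)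
    (hinj : Function.Injective fun ξ : subgroupH1 N (geomTorsion W p) ↦
      (corH1 hN hMp hc ξ, corH1 hN hMp hc (resH1Hom (ContinuousMonoidHom.id N) u hu ξ)))
    (ζ : subgroupH1 N (geomTorsion W p))
    (h1 : W.resOfLe p (κ.kerSubgroup_le_layerSubgroup n)
      (corH1 hN hMT hc (resH1Hom (ContinuousMonoidHom.id N) (AddSubgroup.inclusion (W.geomTorsion_le_geomPrimaryTorsion p))
        (map_subgroup_smul (AddSubgroup.inclusion (W.geomTorsion_le_geomPrimaryTorsion p))
          (fun g a ↦ inclusion_geomTorsion_smul (g : Field.absoluteGaloisGroup ℚ) a)) ζ)) = 0)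
    (h2 : W.resOfLe p (κ.kerSubgroup_le_layerSubgroup n)
      (corH1 hN hMT hc (resH1Hom (ContinuousMonoidHom.id N) (AddSubgroup.inclusion (W.geomTorsion_le_geomPrimaryTorsion p))
        (map_subgroup_smul (AddSubgroup.inclusion (W.geomTorsion_le_geomPrimaryTorsion p))
          (fun g a ↦ inclusion_geomTorsion_smul (g : Field.absoluteGaloisGroup ℚ) a))
        (resH1Hom (ContinuousMonoidHom.id N) u hu ζ))) = 0) :
    ζ = 0 := by
  set ιT : geomTorsion W p →+ W.geomPrimaryTorsion p := AddSubgroup.inclusion (W.geomTorsion_le_geomPrimaryTorsion p) with hιT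
  have hιG : ∀ (g : κ.layerSubgroup n) (a : geomTorsion W p), ιT (g • a) = g • ιT a := fun g a ↦
    inclusion_geomTorsion_smul (g : Field.absoluteGaloisGroup ℚ) a
  have hres := resOfLe_kerSubgroup_injective κ hirr n
  -- both corestricted `W[p^∞]`-classes vanish already over `ℚ_n`
  have e1 : corH1 hN hMT hc (resH1Hom (ContinuousMonoidHom.id N) ιT (map_subgroup_smul ιT hιG) ζ) = 0 :=
    hres (by rw [map_zero]; exact h1)
  have e2 : corH1 hN hMT hc (resH1Hom (ContinuousMonoidHom.id N) ιT (map_subgroup_smul ιT hιG)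
      (resH1Hom (ContinuousMonoidHom.id N) u hu ζ)) = 0 :=
    hres (by rw [map_zero]; exact h2)
  -- naturality of `cor` along `ι` and injectivity of `ι_*` over `ℚ_n`
  rw [← resH1Hom_corH1_comm hN hMp hMT hc ιT hιG] at e1 e2
  have hιinj : Function.Injective (resH1Hom (ContinuousMonoidHom.id (κ.layerSubgroup n)) ιT (fun x a ↦ hιG x a)) :=
    resH1Hom_id_injective_of_torsionBy (H := κ.layerSubgroup n) ιT
      (fun g a ↦ inclusion_geomTorsion_smul (W := W) (p := p) g a) (AddSubgroup.inclusion_injective _) p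
      (fun a ↦ Subtype.ext (by
        rw [AddSubgroupClass.coe_nsmul, ZeroMemClass.coe_zero, ← natCast_zsmul]
        exact (WeierstrassCurve.mem_torsionPoints_iff _ _ (a : geomPoints W)).mp a.2))
      (mem_range_inclusion_of_nsmul_eq_zero (W := W) (p := p)) (forall_layerSubgroup_fixed_eq_zero κ hirr n)
  have f1 : corH1 hN hMp hc ζ = 0 := hιinj (by rw [map_zero]; exact e1)
  have f2 : corH1 hN hMp hc (resH1Hom (ContinuousMonoidHom.id N) u hu ζ) = 0 := hιinj (by rw [map_zero]; exact e2)
  refine hinj ?_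
  change (corH1 hN hMp hc ζ, corH1 hN hMp hc (resH1Hom (ContinuousMonoidHom.id N) u hu ζ)) =
    (corH1 hN hMp hc 0, corH1 hN hMp hc (resH1Hom (ContinuousMonoidHom.id N) u hu 0))
  rw [f1, f2, map_zero, map_zero, map_zero]

end Rational

end Summit.BirchSwinnertonDyer.BirchSwinnertonDyer.Theorems.SmallImageCharSignedSelmer

end
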